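import Mathlib.GroupTheory.QuotientGroup.Basic
import Mathlib.GroupTheory.Index
import Mathlib.SetTheory.Cardinal.Finite
import Mathlib.Algebra.Group.Hom.Basic
import Mathlib.Tactic.Abel
import Mathlib.Tactic.Ring
import HarnessLib

/-!
# A `p`-primary torsion group with FINITE layers has bounded defect from its divisible part:
# `p^e · N ⊆ p^{e+j} · N` for all `j`, for some `e` — pure algebra behind the passage `E[p^k] → E[p^∞]` at the
# RAMIFIED places of Kato's unramified-away-from-`p` structures
# (route `KatoDescentPotSupersingular` / `…Tame…`, crux M = stmt-BirchSwinnertonDyer-19196; route-free TOOL theorems)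

Seat `bsd-potss-rkm` g17 (prover; cell `bsd-potss`), item stmt-BirchSwinnertonDyer-19196 `ReducibleKatoMember`
(`--supports … --as helper`; closes nothing).  HONEST FRAMING: BSD is not proved by any of this; nothing is booked;
theorems only (no definition, no named fact): abstract additive groups.

## What and why

At a bad place `ℓ ≠ p` the inertia invariants `N = E[p^∞]^{I_ℓ}` are `(ℚ_p/ℤ_p)^a ⊕ (finite)`; to lift an UNRAMIFIED
class of `H¹(K_ℓ, E[p^∞])` killed by `p^m` to an UNRAMIFIED class of `H¹(K_ℓ, E[p^{m+e}])` one needs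
"`p^e N` is `p`-divisible" (`e` ≥ the exponent of the finite part).  The tree's n1011 tool
(`GaloisImage.InertiaDivisible.exists_nsmul_eq_of_forall_exists_pow_nsmul_eq`) shows that the infinitely divisible
elements form a divisible set; what is needed here is the complementary BOUND.  For an additive commutative group `G`,
a natural number `p` and a subgroup `N` that is `p`-primary torsion with FINITE layers
`N[p^i] = N ⊓ ker(p^i)` (e.g. any subgroup of `E[p^∞]`):

* `index_layer_succ_le` — `[N[p^{i+2}] : N[p^{i+1}]] ≤ [N[p^{i+1}] : N[p^i]]` (multiplication by `p` induces an
  injection of the quotients);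
* `exists_nsmul_sub_mem_layer` — once the indices are stationary (from `e` on) the injections are bijections: every
  `x ∈ N[p^{i+1}]`, `i ≥ e`, is `p • y` modulo `N[p^i]`; descending, `exists_forall_sub_nsmul_mem_layer`: every `x ∈ N`
  is `≡ p • y (mod N[p^e])`;
* **`exists_pow_nsmul_eq_pow_add_nsmul`** — there is `e` such that for every `x ∈ N` and every `j` there is `d ∈ N`
  with **`p^{e+j} • d = p^e • x`**, i.e. `p^e N` is `p`-divisible inside `N` (`p^e N = p^{e+1} N = ⋯`).

References: standard structure of co-finitely-generated torsion `ℤ_p`-modules (e.g. [GreenbergLNM1716] §3, proof of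
Lemma 3.3, p. 87: "`A^{I_v} ≅ (ℚ_p/ℤ_p)^a × (finite)`"); the proof here is elementary counting.  [folklore]
-/

-- the summit and its single problem are both named `BirchSwinnertonDyer` (registry layout D-0017)
set_option linter.dupNamespace false
set_option autoImplicit false

noncomputable section

namespace Summit.BirchSwinnertonDyer.BirchSwinnertonDyer.Theorems.DivisibleCore

variable {G : Type*} [AddCommGroup G] (N : AddSubgroup G) (p : ℕ)

/-- Membership in the layer `N[p^i] = N ⊓ ker(p^i)`. [folklore] -/
theorem mem_layer_iff (i : ℕ) (x : G) :
    x ∈ N ⊓ (nsmulAddMonoidHom (p ^ i) : G →+ G).ker ↔ x ∈ N ∧ p ^ i • x = 0 := by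
  simp [AddMonoidHom.mem_ker]

/-- The layers increase: `N[p^i] ≤ N[p^{i+1}]`. [folklore] -/
theorem layer_le_succ (i : ℕ) :
    N ⊓ (nsmulAddMonoidHom (p ^ i) : G →+ G).ker ≤ N ⊓ (nsmulAddMonoidHom (p ^ (i + 1)) : G →+ G).ker := by
  intro x hx
  rw [mem_layer_iff] at hx ⊢
  exact ⟨hx.1, by rw [pow_succ', mul_smul, hx.2, smul_zero]⟩

/-- The layers increase: `N[p^a] ≤ N[p^b]` for `a ≤ b`. [folklore] -/
theorem layer_mono {a b : ℕ} (hab : a ≤ b) :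
    N ⊓ (nsmulAddMonoidHom (p ^ a) : G →+ G).ker ≤ N ⊓ (nsmulAddMonoidHom (p ^ b) : G →+ G).ker := by
  induction hab with
  | refl => exact le_rfl
  | step _ ih => exact ih.trans (layer_le_succ N p _)

/-- Multiplication by `p` maps `N[p^{i+1}]` into `N[p^i]`. [folklore] -/
theorem nsmul_mem_layer_of_mem_succ {i : ℕ} {x : G} (hx : x ∈ N ⊓ (nsmulAddMonoidHom (p ^ (i + 1)) : G →+ G).ker) :
    p • x ∈ N ⊓ (nsmulAddMonoidHom (p ^ i) : G →+ G).ker := by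
  rw [mem_layer_iff] at hx ⊢
  exact ⟨N.nsmul_mem hx.1 p, by rw [← mul_smul, ← pow_succ, hx.2]⟩

/-- `x ∈ N[p^{i+1}] ↔ p • x ∈ N[p^i]` for `x ∈ N`. [folklore] -/
theorem mem_layer_succ_iff_nsmul_mem {i : ℕ} {x : G} (hxN : x ∈ N) :
    x ∈ N ⊓ (nsmulAddMonoidHom (p ^ (i + 1)) : G →+ G).ker ↔ p • x ∈ N ⊓ (nsmulAddMonoidHom (p ^ i) : G →+ G).ker := by
  refine ⟨nsmul_mem_layer_of_mem_succ N p, fun h => ?_⟩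
  rw [mem_layer_iff] at h ⊢
  exact ⟨hxN, by rw [pow_succ, mul_smul, h.2]⟩

/-- **Multiplication by `p` induces an INJECTION `N[p^{i+2}]/N[p^{i+1}] ↪ N[p^{i+1}]/N[p^i]`**; hence, with finite layers,
(1) `[N[p^{i+2}] : N[p^{i+1}]] ≤ [N[p^{i+1}] : N[p^i]]`, and (2) if the two indices are EQUAL then every `x ∈ N[p^{i+1}]` is
`p • y` modulo `N[p^i]` for some `y ∈ N[p^{i+2}]` (an injection between finite sets of the same size is onto). [folklore] -/
theorem index_layer_succ_le_and (i : ℕ) [Finite ↥(N ⊓ (nsmulAddMonoidHom (p ^ (i + 1)) : G →+ G).ker)]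
    [Finite ↥(N ⊓ (nsmulAddMonoidHom (p ^ (i + 2)) : G →+ G).ker)] :
    ((N ⊓ (nsmulAddMonoidHom (p ^ (i + 1)) : G →+ G).ker).addSubgroupOf
          (N ⊓ (nsmulAddMonoidHom (p ^ (i + 2)) : G →+ G).ker)).index ≤
        ((N ⊓ (nsmulAddMonoidHom (p ^ i) : G →+ G).ker).addSubgroupOf
          (N ⊓ (nsmulAddMonoidHom (p ^ (i + 1)) : G →+ G).ker)).index ∧
      (((N ⊓ (nsmulAddMonoidHom (p ^ (i + 1)) : G →+ G).ker).addSubgroupOf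
            (N ⊓ (nsmulAddMonoidHom (p ^ (i + 2)) : G →+ G).ker)).index =
          ((N ⊓ (nsmulAddMonoidHom (p ^ i) : G →+ G).ker).addSubgroupOf
            (N ⊓ (nsmulAddMonoidHom (p ^ (i + 1)) : G →+ G).ker)).index →
        ∀ x ∈ N ⊓ (nsmulAddMonoidHom (p ^ (i + 1)) : G →+ G).ker,
          ∃ y ∈ N ⊓ (nsmulAddMonoidHom (p ^ (i + 2)) : G →+ G).ker,
            p • y - x ∈ N ⊓ (nsmulAddMonoidHom (p ^ i) : G →+ G).ker) := by
  set A := N ⊓ (nsmulAddMonoidHom (p ^ i) : G →+ G).ker with hA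
  set B := N ⊓ (nsmulAddMonoidHom (p ^ (i + 1)) : G →+ G).ker with hB
  set C := N ⊓ (nsmulAddMonoidHom (p ^ (i + 2)) : G →+ G).ker with hC
  -- multiplication by `p` as a hom `C → B`, mapping `B` into `A`
  let f : C →+ B :=
    { toFun := fun x => ⟨p • (x : G), nsmul_mem_layer_of_mem_succ N p x.2⟩
      map_zero' := Subtype.ext (by simp)
      map_add' := fun x y => Subtype.ext (by simp [smul_add]) }
  have hf : ∀ x : C, ((f x : B) : G) = p • (x : G) := fun _ => rfl
  have hle : B.addSubgroupOf C ≤ (A.addSubgroupOf B).comap f := fun x hx => by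
    rw [AddSubgroup.mem_comap, AddSubgroup.mem_addSubgroupOf, hf]
    exact nsmul_mem_layer_of_mem_succ N p (AddSubgroup.mem_addSubgroupOf.mp hx)
  set φ := QuotientAddGroup.map (B.addSubgroupOf C) (A.addSubgroupOf B) f hle with hφ
  have hinj : Function.Injective φ := by
    rw [injective_iff_map_eq_zero]
    intro q hq
    induction q using QuotientAddGroup.induction_on with
    | H x =>
      rw [hφ, QuotientAddGroup.map_mk, QuotientAddGroup.eq_zero_iff, AddSubgroup.mem_addSubgroupOf, hf] at hq
      rw [QuotientAddGroup.eq_zero_iff, AddSubgroup.mem_addSubgroupOf]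
      exact (mem_layer_succ_iff_nsmul_mem N p ((mem_layer_iff N p _ _).1 x.2).1).2 hq
  refine ⟨?_, fun heq x hx => ?_⟩
  · rw [AddSubgroup.index_eq_card, AddSubgroup.index_eq_card]
    exact Nat.card_le_card_of_injective _ hinj
  · have hcard : Nat.card (B ⧸ A.addSubgroupOf B) ≤ Nat.card (C ⧸ B.addSubgroupOf C) := by
      rw [← AddSubgroup.index_eq_card, ← AddSubgroup.index_eq_card, heq]
    have hbij : Function.Bijective φ := hinj.bijective_of_nat_card_le hcard
    obtain ⟨q, hq⟩ := hbij.2 (QuotientAddGroup.mk ⟨x, hx⟩)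
    induction q using QuotientAddGroup.induction_on with
    | H y =>
      rw [hφ, QuotientAddGroup.map_mk, QuotientAddGroup.eq_iff_sub_mem, AddSubgroup.mem_addSubgroupOf] at hq
      refine ⟨y, y.2, ?_⟩
      simpa [hf] using hq

/-- **The indices `r_i = [N[p^{i+1}] : N[p^i]]` are eventually constant** (a non-increasing sequence of naturals), for a
subgroup with finite layers. [folklore] -/
theorem exists_index_layer_eq (hfin : ∀ i, Finite ↥(N ⊓ (nsmulAddMonoidHom (p ^ i) : G →+ G).ker)) :
    ∃ e, ∀ i, e ≤ i →
      ((N ⊓ (nsmulAddMonoidHom (p ^ i) : G →+ G).ker).addSubgroupOf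
          (N ⊓ (nsmulAddMonoidHom (p ^ (i + 1)) : G →+ G).ker)).index =
        ((N ⊓ (nsmulAddMonoidHom (p ^ e) : G →+ G).ker).addSubgroupOf
          (N ⊓ (nsmulAddMonoidHom (p ^ (e + 1)) : G →+ G).ker)).index := by
  classical
  set r : ℕ → ℕ := fun i => ((N ⊓ (nsmulAddMonoidHom (p ^ i) : G →+ G).ker).addSubgroupOf
    (N ⊓ (nsmulAddMonoidHom (p ^ (i + 1)) : G →+ G).ker)).index with hr
  have hstep : ∀ i, r (i + 1) ≤ r i := fun i => by
    haveI := hfin (i + 1); haveI := hfin (i + 2)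
    exact (index_layer_succ_le_and N p i).1
  have hanti : ∀ i j, i ≤ j → r j ≤ r i := by
    intro i j hij
    induction hij with
    | refl => exact le_rfl
    | step _ ih => exact (hstep _).trans ih
  obtain ⟨e, he⟩ : ∃ e, ∀ i, r e ≤ r i := by
    have hne : (Set.range r).Nonempty := ⟨_, 0, rfl⟩
    obtain ⟨e, he⟩ := Nat.sInf_mem hne
    exact ⟨e, fun i => he ▸ Nat.sInf_le ⟨i, rfl⟩⟩
  exact ⟨e, fun i hi => le_antisymm (hanti e i hi) (he i)⟩

/-- **Descent through the layers**: if the indices are stationary from `e` on, every `x ∈ N[p^{e+n+1}]` is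
`≡ p • y (mod N[p^e])` for some `y ∈ N`. [folklore] -/
theorem exists_sub_nsmul_mem_layer_of_mem_layer (hfin : ∀ i, Finite ↥(N ⊓ (nsmulAddMonoidHom (p ^ i) : G →+ G).ker))
    {e : ℕ} (he : ∀ i, e ≤ i →
      ((N ⊓ (nsmulAddMonoidHom (p ^ i) : G →+ G).ker).addSubgroupOf
          (N ⊓ (nsmulAddMonoidHom (p ^ (i + 1)) : G →+ G).ker)).index =
        ((N ⊓ (nsmulAddMonoidHom (p ^ e) : G →+ G).ker).addSubgroupOf
          (N ⊓ (nsmulAddMonoidHom (p ^ (e + 1)) : G →+ G).ker)).index) :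
    ∀ n : ℕ, ∀ x ∈ N ⊓ (nsmulAddMonoidHom (p ^ (e + n + 1)) : G →+ G).ker,
      ∃ y ∈ N, x - p • y ∈ N ⊓ (nsmulAddMonoidHom (p ^ e) : G →+ G).ker := by
  -- the lifting step at index `i ≥ e`
  have step : ∀ i, e ≤ i → ∀ x ∈ N ⊓ (nsmulAddMonoidHom (p ^ (i + 1)) : G →+ G).ker,
      ∃ y ∈ N ⊓ (nsmulAddMonoidHom (p ^ (i + 2)) : G →+ G).ker,
        p • y - x ∈ N ⊓ (nsmulAddMonoidHom (p ^ i) : G →+ G).ker := by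
    intro i hi
    haveI := hfin (i + 1); haveI := hfin (i + 2)
    exact (index_layer_succ_le_and N p i).2 ((he (i + 1) (by omega)).trans (he i hi).symm)
  intro n
  induction n with
  | zero =>
    intro x hx
    obtain ⟨y, hy, hyx⟩ := step e le_rfl x (by simpa using hx)
    refine ⟨y, ((mem_layer_iff N p _ _).1 hy).1, ?_⟩
    have : x - p • y = -(p • y - x) := by abel
    rw [this]
    exact neg_mem hyx
  | succ n ih =>
    intro x hx
    have hx' : x ∈ N ⊓ (nsmulAddMonoidHom (p ^ ((e + n + 1) + 1)) : G →+ G).ker := by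
      have : e + (n + 1) + 1 = (e + n + 1) + 1 := by omega
      rw [this] at hx; exact hx
    obtain ⟨y, hy, hyx⟩ := step (e + n + 1) (by omega) x hx'
    obtain ⟨y', hy', hr⟩ := ih (p • y - x) hyx
    refine ⟨y - y', N.sub_mem ((mem_layer_iff N p _ _).1 hy).1 hy', ?_⟩
    have : x - p • (y - y') = -(p • y - x - p • y') := by rw [smul_sub]; abel
    rw [this]
    exact neg_mem hr

/-- **Every `x ∈ N` is `≡ p • y (mod N[p^e])` for some `y ∈ N`**, for a `p`-primary torsion subgroup `N` with finite layers
(so `p^e • x = p^{e+1} • y`: `p^e N = p^{e+1} N`). [folklore] -/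
theorem exists_forall_sub_nsmul_mem_layer (hfin : ∀ i, Finite ↥(N ⊓ (nsmulAddMonoidHom (p ^ i) : G →+ G).ker))
    (htors : ∀ x ∈ N, ∃ i, p ^ i • x = 0) :
    ∃ e, ∀ x ∈ N, ∃ y ∈ N, x - p • y ∈ N ⊓ (nsmulAddMonoidHom (p ^ e) : G →+ G).ker := by
  obtain ⟨e, he⟩ := exists_index_layer_eq N p hfin
  refine ⟨e, fun x hx => ?_⟩
  obtain ⟨i, hi⟩ := htors x hx
  have hx' : x ∈ N ⊓ (nsmulAddMonoidHom (p ^ (e + i + 1)) : G →+ G).ker :=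
    layer_mono N p (by omega : i ≤ e + i + 1) ((mem_layer_iff N p i x).2 ⟨hx, hi⟩)
  exact exists_sub_nsmul_mem_layer_of_mem_layer N p hfin he i x hx'

/-- **`p^e N` is `p`-divisible inside `N`**: for a `p`-primary torsion subgroup `N ≤ G` with FINITE layers `N[p^i]`
there is `e` such that for every `x ∈ N` and every `j` some `d ∈ N` has `p^{e+j} • d = p^e • x`.  (Structure of
co-finitely-generated torsion `ℤ_p`-modules, `N ≅ (ℚ_p/ℤ_p)^a ⊕ F`, `p^e F = 0`; proved here by counting layers.)
[folklore] -/
theorem exists_pow_nsmul_eq_pow_add_nsmul (hfin : ∀ i, Finite ↥(N ⊓ (nsmulAddMonoidHom (p ^ i) : G →+ G).ker))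
    (htors : ∀ x ∈ N, ∃ i, p ^ i • x = 0) :
    ∃ e, ∀ x ∈ N, ∀ j : ℕ, ∃ d ∈ N, p ^ (e + j) • d = p ^ e • x := by
  obtain ⟨e, he⟩ := exists_forall_sub_nsmul_mem_layer N p hfin htors
  refine ⟨e, fun x hx j => ?_⟩
  induction j generalizing x with
  | zero => exact ⟨x, hx, by rw [add_zero]⟩
  | succ j ih =>
    obtain ⟨y, hy, hxy⟩ := he x hx
    obtain ⟨d, hd, hdy⟩ := ih y hy
    refine ⟨d, hd, ?_⟩
    -- `p^e • x = p^e • p • y` and `p^{e+j} • d = p^e • y`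
    have h1 : p ^ e • x = p ^ e • (p • y) := by
      have h0 := ((mem_layer_iff N p e _).1 hxy).2
      rwa [smul_sub, sub_eq_zero] at h0
    rw [h1, ← mul_smul, mul_comm, mul_smul, ← hdy, ← mul_smul]
    congr 1
    ring

end Summit.BirchSwinnertonDyer.BirchSwinnertonDyer.Theorems.DivisibleCore

end
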